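import Literature.MathematicalPhysics.QuantumLattice.GrassmannReflectionPositivity
import Literature.MathematicalPhysics.QuantumLattice.GrassmannParity
import HarnessLib

/-!
# Hermitian squares `A · ΘA` in a Grassmann algebra: the cone identity for homogeneous elements and
# the top pairing for sum-of-hermitian-squares weights

Topic `Literature/MathematicalPhysics/QuantumLattice`.  The reflection-positivity argument of
Osterwalder–Seiler for lattice fermions (`GrassmannReflectionPositivity`) multiplies `G · ΘH` by a
weight that is a positive combination of CONE terms `X_t ΘX_t`, `X_t` an increasing product of
degree-one elements, and pairs the top coefficients.  This file records the (equally elementary) general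
form, needed when the weight is only known to be a positive combination of HERMITIAN SQUARES `A ΘA` with
`A` homogeneous (even or odd) but not a monomial — e.g. the Gaussian-corrected crossing factor of the
`U(N)` staggered model for `N ≥ 2` (cell pub-ymgap, seat qcd-lit g21, lead S3-GC(N)):

* `mul_eq_mul_involute_of_mem_evenOdd_one` — **odd elements super-commute**: `y · a = a · ι(y)` for odd
  `a` and every `y` (`ι` the parity involution); even elements are central
  (`commute_of_mem_evenOdd_zero`, `GrassmannParity`);
* `Reflection.map_mem_evenOdd` — a reflection preserves parity;
* `mul_map_mul_mul_map_of_mem_evenOdd` — **the cone identity for homogeneous elements**: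
  `G · ΘH · (A · ΘA') = (G A) · Θ(H A')` for `A, A'` of the same parity
  (`mul_map_mul_ι_mul_map_ι` is the degree-one case); hence hermitian squares are closed under products
  (`hermSq_mul_hermSq`);
* `berezin_mul_map_mul_sum_hermSq` — **the top pairing with a sum-of-hermitian-squares weight**:
  `∫dθ G · ΘH · Σ_k λ_k A_k ΘA_k = s_Θ Σ_k λ_k (G A_k)_P conj (H A_k)_P`; for `H = G` and `λ_k ≥ 0` the sum
  is `≥ 0` (`re_sum_mul_mul_conj_nonneg`).

Everything is proved; no named fact. [folklore]

## Sources

K. Osterwalder, E. Seiler, Ann. Phys. 110 (1978) 440, §3 (`OsterwalderSeiler1978`,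
`OsterwalderSeilerAnnPhys1978`); F. A. Berezin, *The Method of Second Quantization* (1966), Ch. I §3
(`Berezin1966`).
-/

noncomputable section

namespace Literature.MathematicalPhysics.QuantumLattice

namespace GrassmannAlgebra

open scoped ComplexConjugate

variable {ι : Type*}

/-! ### Odd elements super-commute; reflections preserve parity -/

/-- **Odd elements super-commute with everything**: `y · a = a · ι(y)` for `a` odd, `ι` the parity
involution. [cite: Berezin1966, Ch. I §3] -/
theorem mul_eq_mul_involute_of_mem_evenOdd_one {a : GrassmannAlgebra ℂ ι} (ha : a ∈ evenOdd ℂ 1)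
    (y : GrassmannAlgebra ℂ ι) : y * a = a * CliffordAlgebra.involute y := by
  induction a, ha using CliffordAlgebra.odd_induction with
  | ι v => exact mul_ι_eq_ι_mul_involute v y
  | add x z hx hz ihx ihz => rw [mul_add, add_mul, ihx, ihz]
  | ι_mul_ι_mul m₁ m₂ x hx ih =>
    have hc := (commute_of_mem_evenOdd_zero ℂ (CliffordAlgebra.ι_mul_ι_mem_evenOdd_zero _ m₁ m₂) y).eq
    calc y * (CliffordAlgebra.ι _ m₁ * CliffordAlgebra.ι _ m₂ * x)
        = CliffordAlgebra.ι _ m₁ * CliffordAlgebra.ι _ m₂ * (y * x) := by rw [← mul_assoc, ← hc, mul_assoc]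
      _ = CliffordAlgebra.ι _ m₁ * CliffordAlgebra.ι _ m₂ * x * CliffordAlgebra.involute y := by rw [ih, ← mul_assoc]

/-- A reflection maps `(range ι)^n` into the part of parity `n`. [cite: OsterwalderSeiler1978, §3] -/
theorem Reflection.map_mem_evenOdd_of_mem_pow (Θ : Reflection ι) {n : ℕ} {v : GrassmannAlgebra ℂ ι}
    (hv : v ∈ LinearMap.range (CliffordAlgebra.ι (0 : QuadraticForm ℂ (ι → ℂ))) ^ n) :
    Θ v ∈ evenOdd ℂ (n : ZMod 2) := by
  induction hv using Submodule.pow_induction_on_left' with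
  | algebraMap r =>
    rw [Algebra.algebraMap_eq_smul_one, Θ.map_smul, Θ.map_one, Nat.cast_zero]
    exact Submodule.smul_mem _ _ (SetLike.one_mem_graded _)
  | add x y n hx hy ihx ihy =>
    rw [Θ.map_add]; exact Submodule.add_mem _ ihx ihy
  | mem_mul m hm n x hx ih =>
    obtain ⟨w, rfl⟩ := LinearMap.mem_range.1 hm
    obtain ⟨w', hw'⟩ := Θ.exists_map_ι w
    have h1 : (ExteriorAlgebra.ι ℂ w' : GrassmannAlgebra ℂ ι) ∈ evenOdd ℂ (1 : ZMod 2) := CliffordAlgebra.ι_mem_evenOdd_one _ _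
    have h2 := SetLike.mul_mem_graded ih h1
    rw [Θ.map_mul, show (CliffordAlgebra.ι _ w : GrassmannAlgebra ℂ ι) = ExteriorAlgebra.ι ℂ w from rfl, hw', Nat.cast_succ]
    exact h2

/-- **A reflection preserves parity.** [cite: OsterwalderSeiler1978, §3] -/
theorem Reflection.map_mem_evenOdd (Θ : Reflection ι) {i : ZMod 2} {a : GrassmannAlgebra ℂ ι} (ha : a ∈ evenOdd ℂ i) :
    Θ a ∈ evenOdd ℂ i := by
  induction a, ha using CliffordAlgebra.evenOdd_induction with
  | range_ι_pow v hv =>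
    have h := Θ.map_mem_evenOdd_of_mem_pow hv
    rwa [ZMod.natCast_zmod_val] at h
  | add x z hx hz ihx ihz => rw [Θ.map_add]; exact Submodule.add_mem _ ihx ihz
  | ι_mul_ι_mul m₁ m₂ x hx ih =>
    obtain ⟨w₁, hw₁⟩ := Θ.exists_map_ι m₁
    obtain ⟨w₂, hw₂⟩ := Θ.exists_map_ι m₂
    rw [Θ.map_mul, Θ.map_mul, show (CliffordAlgebra.ι _ m₁ : GrassmannAlgebra ℂ ι) = ExteriorAlgebra.ι ℂ m₁ from rfl,
      show (CliffordAlgebra.ι _ m₂ : GrassmannAlgebra ℂ ι) = ExteriorAlgebra.ι ℂ m₂ from rfl, hw₁, hw₂]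
    have h0 : (ExteriorAlgebra.ι ℂ w₂ * ExteriorAlgebra.ι ℂ w₁ : GrassmannAlgebra ℂ ι) ∈ evenOdd ℂ (0 : ZMod 2) :=
      CliffordAlgebra.ι_mul_ι_mem_evenOdd_zero _ _ _
    have := SetLike.mul_mem_graded ih h0
    rwa [add_zero] at this

/-! ### The cone identity for homogeneous elements; hermitian squares are closed under products -/

/-- **The cone identity for homogeneous elements**: `G · ΘH · (A · ΘA') = (G A) · Θ(H A')` whenever
`A, A'` have the same parity (moving `A` through `ΘH` twists by the parity involution when `A` is odd,
and `Θ` undoes the twist on the other side). [cite: OsterwalderSeiler1978, §3] -/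
theorem mul_map_mul_mul_map_of_mem_evenOdd (Θ : Reflection ι) (G H : GrassmannAlgebra ℂ ι) {i : ZMod 2}
    {A A' : GrassmannAlgebra ℂ ι} (hA : A ∈ evenOdd ℂ i) (hA' : A' ∈ evenOdd ℂ i) :
    G * Θ H * (A * Θ A') = G * A * Θ (H * A') := by
  rw [Θ.map_mul]
  fin_cases i
  · have h1 := (commute_of_mem_evenOdd_zero ℂ hA (Θ H)).eq
    have h2 := (commute_of_mem_evenOdd_zero ℂ (Θ.map_mem_evenOdd hA') (Θ H)).eq
    rw [← mul_assoc, mul_assoc G (Θ H) A, ← h1, ← mul_assoc, mul_assoc (G * A), ← h2]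
  · have h1 : Θ H * A = A * CliffordAlgebra.involute (Θ H) := mul_eq_mul_involute_of_mem_evenOdd_one hA (Θ H)
    have h2 : CliffordAlgebra.involute (Θ H) * Θ A' = Θ A' * Θ H := by
      rw [mul_eq_mul_involute_of_mem_evenOdd_one (Θ.map_mem_evenOdd hA') , CliffordAlgebra.involute_involute]
    rw [← mul_assoc, mul_assoc G (Θ H) A, h1, ← mul_assoc, mul_assoc (G * A), h2]

/-- **Hermitian squares are closed under products**: `(A ΘA)(B ΘB) = (AB) Θ(AB)` for homogeneous `B`. [cite: OsterwalderSeiler1978, §3] -/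
theorem hermSq_mul_hermSq (Θ : Reflection ι) (A : GrassmannAlgebra ℂ ι) {j : ZMod 2} {B : GrassmannAlgebra ℂ ι}
    (hB : B ∈ evenOdd ℂ j) : (A * Θ A) * (B * Θ B) = (A * B) * Θ (A * B) :=
  mul_map_mul_mul_map_of_mem_evenOdd Θ A A hB hB

/-- A scalar hermitian square: `(c • A) Θ(c • A) = |c|² • A ΘA`. [cite: OsterwalderSeiler1978, §3] -/
theorem smul_mul_map_smul (Θ : Reflection ι) (c : ℂ) (A : GrassmannAlgebra ℂ ι) :
    (c • A) * Θ (c • A) = ((c * conj c : ℂ)) • (A * Θ A) := by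
  rw [Θ.map_smul, smul_mul_smul_comm]

/-! ### The top pairing with a sum-of-hermitian-squares weight -/

section TopPairing

variable [LinearOrder ι] [Fintype ι] {P : Finset ι} {σ : ι → ι} {ε : ι → ℂ} (Θ : Reflection ι)

/-- **The top pairing with a sum-of-hermitian-squares weight**: for `G, H, A_k ∈ Λ_P` with `A_k`
homogeneous, `∫dθ G · ΘH · Σ_k λ_k A_k ΘA_k = s_Θ · Σ_k λ_k (G A_k)_P conj (H A_k)_P`, `s_Θ = ∫ θ_P Θθ_P`. [cite: OsterwalderSeiler1978, §3] -/
theorem berezin_mul_map_mul_sum_hermSq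
    (hΘ : ∀ p ∈ P, Θ (gen ℂ p) = ε p • gen ℂ (σ p)) (himg : P.image σ = Pᶜ) (hinj : Set.InjOn σ P)
    {κ : Type*} (s : Finset κ) (lam : κ → ℂ) {A : κ → GrassmannAlgebra ℂ ι} {par : κ → ZMod 2}
    (hA : ∀ k, A k ∈ evenOdd ℂ (par k)) (hAP : ∀ k, A k ∈ spectatorSubalgebra ℂ Pᶜ)
    {G H : GrassmannAlgebra ℂ ι} (hG : G ∈ spectatorSubalgebra ℂ Pᶜ) (hH : H ∈ spectatorSubalgebra ℂ Pᶜ) :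
    berezin ℂ ι (G * Θ H * ∑ k ∈ s, lam k • (A k * Θ (A k))) =
      berezin ℂ ι (grassmannBasis ℂ ι P * Θ (grassmannBasis ℂ ι P)) *
        ∑ k ∈ s, lam k * ((grassmannBasis ℂ ι).coord P (G * A k) * conj ((grassmannBasis ℂ ι).coord P (H * A k))) := by
  rw [Finset.mul_sum, _root_.map_sum, Finset.mul_sum]
  refine Finset.sum_congr rfl fun k _ => ?_
  rw [mul_smul_comm, _root_.map_smul, mul_map_mul_mul_map_of_mem_evenOdd Θ G H (hA k) (hA k),
    berezin_mul_map_of_mem_spectator Θ hΘ himg hinj (Subalgebra.mul_mem _ hG (hAP k))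
      (Subalgebra.mul_mem _ hH (hAP k)), smul_eq_mul]
  ring

end TopPairing

/-- The diagonal pairing is non-negative: `Σ_k λ_k c_k conj c_k ≥ 0` for `λ_k ≥ 0` (the positivity step of the
Osterwalder–Seiler argument). [cite: OsterwalderSeiler1978, §3] -/
theorem re_sum_mul_mul_conj_nonneg {κ : Type*} (s : Finset κ) {lam : κ → ℝ} (hlam : ∀ k, 0 ≤ lam k) (c : κ → ℂ) :
    0 ≤ (∑ k ∈ s, (lam k : ℂ) * (c k * conj (c k))).re ∧ (∑ k ∈ s, (lam k : ℂ) * (c k * conj (c k))).im = 0 := by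
  have h : ∑ k ∈ s, (lam k : ℂ) * (c k * conj (c k)) = ((∑ k ∈ s, lam k * Complex.normSq (c k) : ℝ) : ℂ) := by
    rw [Complex.ofReal_sum]
    exact Finset.sum_congr rfl fun k _ => by rw [Complex.mul_conj, Complex.ofReal_mul]
  rw [h, Complex.ofReal_re, Complex.ofReal_im]
  exact ⟨Finset.sum_nonneg fun k _ => mul_nonneg (hlam k) (Complex.normSq_nonneg _), rfl⟩

end GrassmannAlgebra

end Literature.MathematicalPhysics.QuantumLattice

end
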